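import Literature.Computability.Cryptography.VanDamSeroussiOracle2FP
import Literature.Computability.Cryptography.VanDamSeroussiOracleBQP
import HarnessLib

/-!
# The oracle language of the van Dam–Seroussi circuit, IIc: the extended language is in `BQP`

Topic `Literature/Computability/Cryptography`; sequel of `VanDamSeroussiOracle2.lean` (`lang₂`),
`VanDamSeroussiOracle2FP.lean` (`codeFP_valOfP₂`) and `VanDamSeroussiOracleBQP.lean` (`lang ∈ BQP`:
Shor's discrete logarithms and integer factoring wrapped classically, `postBit`, `postBit_eq_specBit`,
`isQSolvable_innerRel`, `codeFP_preSpec`), for the discharge of `VanDamSeroussi2002_gaussSumPhase_qsolvable`.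
The extended language differs from `lang` only in the ARITHMETIC kinds `12–20`, which the classical
post-processor evaluates itself; the factoring and discrete-logarithm branches are literally those of
`postBit`. Hence (Bernstein–Vazirani 1997, §8; Bennett–Bernstein–Brassard–Vazirani 1997, Cor. 4.15)
**`VDSOracle.lang₂_mem_BQP : lang₂ ∈ BQP`** — the oracle of the gadget-free copy is admissible for
`isQSolvable_of_generated_oracle_circuits`. All proofs complete; no named fact.

## References

* P. W. Shor, SIAM J. Comput. 26 (1997), §5, §6 [Shor1997].
* E. Bernstein, U. Vazirani, SIAM J. Comput. 26 (1997), §8 [BernsteinVazirani1997].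
* C. H. Bennett, E. Bernstein, G. Brassard, U. Vazirani, SIAM J. Comput. 26 (1997), Cor. 4.15 [BennettBernsteinBrassardVazirani1997].
* S. Arora, B. Barak, CUP 2009, §1.3, §10.2 [AroraBarak2009].
-/

noncomputable section

namespace Literature.Computability.Cryptography

namespace VDSOracle

open _root_.Computability Complexity Complexity.Brick Complexity.CodeFP Complexity.ModArith QuantumComplexity

/-! ### The extended post-processor -/

/-- **The extended post-processor**: the factoring and discrete-logarithm branches of `postBit`, and the
arithmetic value `valOf₂` otherwise. [cite: Shor1997, §5 and §6] [cite: VanDamSeroussi2002, §4 Algorithm 1] -/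
def postBit₂ (q : Query) (out : List Bool) : Bool :=
  if q.tag = tagFACT then postBit q out
  else if q.tag = tagDLOG then postBit q out
  else (if q.tag = tagDLOG then 0 else valOf₂ q).testBit q.idx

/-- **The extended post-processor is polynomial time** (pair form). [cite: AroraBarak2009, §1.3] -/
theorem codeFP_postBitPair₂ : CodeFP (pairE Query.code strE) bitE (fun t => postBit₂ t.1 t.2) := by
  obtain ⟨-, -, -, -, ht, hi, -⟩ := codeFP_fields
  have hQ : CodeFP (pairE Query.code strE) Query.code (fun t => t.1) := fst _ _
  have hI : CodeFP (pairE Query.code strE) natE (fun t => t.1.idx) := hi.comp hQ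
  have hTag : ∀ k : ℕ, CodeFP (pairE Query.code strE) bitE (fun t => decide (t.1.tag = k)) := fun k =>
    (eq unE_injective).comp ((ht.comp hQ).pair (const _ k))
  have hV : CodeFP (pairE Query.code strE) natE (fun t => if t.1.tag = tagDLOG then 0 else valOf₂ t.1) := codeFP_valOfP₂.comp hQ
  have harith := codeFP_testBit.comp (hV.pair hI)
  refine ((hTag tagFACT).ite codeFP_postBitPair ((hTag tagDLOG).ite codeFP_postBitPair harith)).congr fun t => ?_
  dsimp only
  rw [postBit₂]
  by_cases h0 : t.1.tag = tagFACT
  · rw [decide_eq_true h0, if_pos rfl, if_pos h0]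
  · rw [decide_eq_false h0, if_neg Bool.false_ne_true, if_neg h0]
    by_cases h1 : t.1.tag = tagDLOG
    · rw [decide_eq_true h1, if_pos rfl, if_pos h1]
    · rw [decide_eq_false h1, if_neg Bool.false_ne_true, if_neg h1, if_neg h1]

/-- The extended post-processor as a function of the string `⟨query, output⟩`. [cite: AroraBarak2009, §1.3] -/
theorem codeFP_postBit₂ : CodeFP strE bitE (fun v => postBit₂ (parse (fstF v)) (sndF v)) :=
  codeFP_postBitPair₂.comp ((codeFP_parse.comp ⟨fstF, fstF_mem_FP, fun _ => rfl⟩).pair ⟨sndF, sndF_mem_FP, fun _ => rfl⟩)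

/-- **The extended post-processor returns the answer bit** on any valid output of the inner solver.
[cite: Shor1997, §5 and §6] -/
theorem postBit₂_eq_specBit₂ (w : List Bool) {out : List Bool} (hout : out ∈ innerRel (preSpec w)) :
    postBit₂ (parse w) out = specBit₂ (parse w) := by
  set q := parse w with hq
  by_cases h0 : q.tag = tagFACT
  · rw [postBit₂, if_pos h0, postBit_eq_specBit w hout, ← hq, specBit₂_of_lt (by rw [h0]; decide)]
  · by_cases h1 : q.tag = tagDLOG
    · rw [postBit₂, if_neg h0, if_pos h1, postBit_eq_specBit w hout, ← hq, specBit₂_of_lt (by rw [h1]; decide)]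
    · rw [postBit₂, if_neg h0, if_neg h1, if_neg h1, specBit₂, if_neg h0]

/-! ### The extended language is in `BQP` -/

/-- **The extended oracle language of the van Dam–Seroussi circuit is in `BQP`.**
[cite: Shor1997, §5 and §6] [cite: BernsteinVazirani1997, §8] [cite: BennettBernsteinBrassardVazirani1997, Cor. 4.15] -/
theorem lang₂_mem_BQP : lang₂ ∈ BQP := by
  obtain ⟨h, hh, hh_eq⟩ := codeFP_preSpec
  have hpre : preSpec ∈ FP := by
    have : h = preSpec := funext fun w => hh_eq w
    rw [← this]; exact hh
  obtain ⟨g, hg, hg_eq⟩ := codeFP_postBit₂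
  have hW := isQSolvable_classicalWrap_holds preSpec g hpre hg isQSolvable_innerRel
  have hbit : IsQSolvable fun w => {z | [specBit₂ (parse w)] <+: z} := by
    refine hW.mono fun w z hz => ?_
    obtain ⟨y, hy, hz⟩ := hz
    have hgy : g (boolPair w y) = [specBit₂ (parse w)] := by
      have := hg_eq (boolPair w y)
      dsimp only at this
      rw [fstF_boolPair, sndF_boolPair, postBit₂_eq_specBit₂ w hy] at this
      exact this
    rw [hgy] at hz
    exact hz
  exact mem_BQP_of_isQSolvable_bit (fun _ _ => QCircuit.outputPMF_apply_holds) cliffordT_isUnitary_holds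
    (fun w => (mem_lang₂_iff w).symm) hbit

end VDSOracle

end Literature.Computability.Cryptography

end
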